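import Mathlib

/-!
# The graded norm lemma: algebraic core of THEOREM A′ of the cell programme (solo seat `solo-Langlands-informed`)

New mathematics relative to the audited statement `Summit.Langlands` (not a reproduction; no
summit bearing is claimed — this is bookkeeping of the reducible locus at the cyclotomic
Eisenstein ideal, paper/EtaleDirection.md §7.11 (16.13)(p)).

Setting in the paper: `L/K` cyclic of degree `7` inside `Γ = G ⋊ Δ_η`, `A = Cl_S(L) ⊗ ℤ₇`,
`C = Cl_S(K) ⊗ ℤ₇`, `N` the norm, `e_i` the `ω^i`-isotypic projectors for `Δ_η`, and
`T = G₁ = Σ_a ω̃(a)⁻¹ σ^a` the degree-one resolvent with `T·A = (σ-1)·A` (LEMMA R).  At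
`g = 0` the norm induces `A/(σ-1)A ≅ C`, i.e. `ker N = T·A`; `T` raises the degree by one
(`e₁ ∘ T = T ∘ e₀` on the relevant pieces); and `A₀ = e₀ A = 0` exactly when `7 ∤ h_S(F_η)`.
The three statements below are the abstract skeleton of THEOREM A′ (ii):

* `soloInformed_eq_zero_of_degOne_of_norm_eq_zero` — if `e₁ ∘ T = T ∘ e₀`, `e₀ = 0` and
  `ker N ⊆ range T`, then `N` kills no non-zero element of degree one;
* `soloInformed_degOne_norm_injective` — hence `N` is injective on degree one;
* `soloInformed_degOne_torsion_lift` — and if moreover `N` is surjective and equivariant for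
  the projectors, every `n`-torsion element of degree one of `C` is the norm of an `n`-torsion
  element of degree one of `A` (the paper uses `n = 7`: `N_*(A₁[7]) = C₁[7]`, which is the
  statement `n₆ = [|S_η| = 1] + w`).

Everything is stated for additive monoid homomorphisms of abelian groups; no number theory is
formalised here.
-/

namespace Summit.Langlands.Langlands.Theorems

variable {A C : Type*} [AddCommGroup A] [AddCommGroup C]

/-- **Degree one meets the kernel of the norm trivially.**  If `T` raises degree zero to degree
one (`e₁ (T a) = T (e₀ a)`), the degree-zero projector vanishes (`e₀ = 0`), and the kernel of
`N` is contained in the range of `T`, then an element fixed by `e₁` and killed by `N` is `0`. -/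
theorem soloInformed_eq_zero_of_degOne_of_norm_eq_zero
    (e₀ e₁ T : A →+ A) (N : A →+ C)
    (hT : ∀ a, e₁ (T a) = T (e₀ a)) (he₀ : e₀ = 0)
    (hker : ∀ a, N a = 0 → ∃ b, a = T b)
    {a : A} (ha : e₁ a = a) (hNa : N a = 0) : a = 0 := by
  obtain ⟨b, rfl⟩ := hker a hNa
  have h : e₁ (T b) = 0 := by
    rw [hT b, he₀, AddMonoidHom.zero_apply, map_zero]
  calc T b = e₁ (T b) := ha.symm
    _ = 0 := h

/-- **The norm is injective on degree one** (under the hypotheses of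
`soloInformed_eq_zero_of_degOne_of_norm_eq_zero`). -/
theorem soloInformed_degOne_norm_injective
    (e₀ e₁ T : A →+ A) (N : A →+ C)
    (hT : ∀ a, e₁ (T a) = T (e₀ a)) (he₀ : e₀ = 0)
    (hker : ∀ a, N a = 0 → ∃ b, a = T b)
    {a a' : A} (ha : e₁ a = a) (ha' : e₁ a' = a') (h : N a = N a') : a = a' := by
  have hsub : a - a' = 0 :=
    soloInformed_eq_zero_of_degOne_of_norm_eq_zero e₀ e₁ T N hT he₀ hker
      (a := a - a') (by rw [map_sub, ha, ha']) (by rw [map_sub, h, sub_self])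
  exact sub_eq_zero.mp hsub

/-- **Torsion lifting in degree one.**  If in addition `e₁` is idempotent, `N` intertwines `e₁`
with a projector `e₁'` of `C`, and `N` is surjective, then every `n`-torsion element of `C`
fixed by `e₁'` is the image of an `n`-torsion element of `A` fixed by `e₁`.  (Paper: with
`n = 7`, `N_*(A₁[7]) = C₁[7]`, whence `n₆ = [|S_η| = 1] + w` at `g = 0`, `7 ∤ h_S(F_η)`.) -/
theorem soloInformed_degOne_torsion_lift
    (e₀ e₁ T : A →+ A) (e₁' : C →+ C) (N : A →+ C)
    (hT : ∀ a, e₁ (T a) = T (e₀ a)) (he₀ : e₀ = 0)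
    (hker : ∀ a, N a = 0 → ∃ b, a = T b)
    (hidem : ∀ a, e₁ (e₁ a) = e₁ a) (hequiv : ∀ a, N (e₁ a) = e₁' (N a))
    (hsurj : Function.Surjective N) (n : ℕ) {c : C} (hc : e₁' c = c) (hnc : n • c = 0) :
    ∃ a : A, e₁ a = a ∧ n • a = 0 ∧ N a = c := by
  obtain ⟨a₀, ha₀⟩ := hsurj c
  refine ⟨e₁ a₀, hidem a₀, ?_, by rw [hequiv, ha₀, hc]⟩
  apply soloInformed_eq_zero_of_degOne_of_norm_eq_zero e₀ e₁ T N hT he₀ hker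
  · rw [map_nsmul, hidem]
  · rw [map_nsmul, hequiv, ha₀, hc, hnc]

end Summit.Langlands.Langlands.Theorems
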